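import Summits.HodgeConjecture.HodgeConjecture.Theorems.F0P3OrbitSmoothVectors
import Summits.HodgeConjecture.HodgeConjecture.Theorems.F0P3CMFrameOrbit
import HarnessLib

/-!
# FLOOR-0 P3 — rung-1 brick B1′ (algebraic half): the VALUE MAP `φ(Y) = ∑ⱼ Y_{(inl j)(inr 0)} • vⱼ` of a pair of vectors of
# cotangent `K`-type in a `(𝔤, K)`-module of `U(2,1)_{Fin 2 ⊕ Fin 1}` is a TYPED NULL VALUE MAP (h0 ∕ hK ∕ h𝔨 ∕ hwt ∕ hN)

Cell hodgecm-mathlib, FLOOR 0, crux item H413 = stmt-HodgeConjecture-24833; brief B1′ of the P3 integrator (F0P3-plan (g0)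
2026-08-31T00:17:32Z), author F0P3-p01 (g3).  PROOF lane (no `def`, no instance, no named fact).  GENERIC in the
`(𝔤, K)`-module `V` (any `IsGKModule (uFormGroup (Fin 2) (Fin 1)) ρK ρ𝔤`), so that the consumer instantiates it at
`V := P.archModuleCM ι T hT` (★ `DiscreteAutomorphicRepArchModuleCM`) with the vectors `vⱼ = [Φⱼ]` supplied by
`Theorems/F0P3CotangentFormValueMap.lean`, and the output plugs token for token into the `φp` ∕ `φm` binders of ★
`F0P3ValueMapTransport.not_both_types_of_detected` and ★ `F0P3ArchValueMapRigidity`.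

INPUT (holomorphic case): two vectors `v₀, v₁ ∈ V` with
* (hKv) the COTANGENT `K`-TYPE `ρK(k) vⱼ = ∑ᵢ conj(k₂₂) kᵢⱼ • vᵢ` for `k = diag(k₁₁, k₂₂) ∈ K = U(2) × U(1)` (the classes of the
  coordinates of a holomorphic cotangent form, ★ `F0P3CMFrameOrbit.apply_mul_cmArchSectionUForm_K`);
* (hCR) the CAUCHY–RIEMANN relations `ρ𝔤(X_{icE_p}) vⱼ = i • ρ𝔤(X_{cE_p}) vⱼ` on the frame `X_{cE_p} = upqUnit p c` of `𝔭`.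
OUTPUT: for every real-linear `φ : 𝔤 → V` with `φ(Y) = ∑ⱼ Y_{(inl j)(inr 0)} • vⱼ` (it exists, `exists_valueMap`; and
`φ (upqUnit p c) = c • v_{p.1}`): (h0) `φ(𝔨) = 0`; (hK) `ρK(k) φ(Y) = φ(Ad(k) Y)`; (h𝔨) `φ(⁅W, Y⁆) = ρ𝔤(W) φ(Y)`, `W ∈ 𝔨` (★
`F0P3OrbitSmoothVectors.lie_apply_eq_of_K_equivariant`); (hwt) `ρ𝔤(z₀) φ(Y) = i • φ(Y)`; (hN)
`ρ𝔤(x_s) φ(Y) + i • ρ𝔤(⁅z₀, x_s⁆) φ(Y) = 0` — `valueMap_hol`; and `φ = 0 ↔ v = 0`.  The ANTIHOLOMORPHIC twin `valueMap_antihol`: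
conjugate `K`-type `ρK(k) wⱼ = ∑ᵢ k₂₂ conj(kᵢⱼ) • wᵢ`, anti-CR `ρ𝔤(X_{ic}) wⱼ = −i • ρ𝔤(X_c) wⱼ`, conjugate-linear value map
`φ(Y) = ∑ⱼ conj(Y_{(inl j)(inr 0)}) • wⱼ`, types `−i`.

Mathematics: Borel–Wallach, II §4.1–4.2 (the `𝔭^±` types of `𝔤`-valued cochains), VI 4.7–4.8 (`K = U(n) × U(1)`, `τ₁` on `𝔭₊`);
the value map of a `(1,0)`-form `ω` is `X ↦ ω(dL_g X̃)`, complex-linear on `𝔭 ≅ T_{x₀} 𝔹²`, and `K`-equivariant because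
`(Ad k X)~ = dL_k X̃`.
References: [BorelWallach2000] II §4.1–4.2, VI 4.7–4.8; [Rogawski1990] Prop. 15.2.1 (b); [Borel1997] §5.14.
HONEST LABEL: HC_CM is proved only modulo the printed citations until rung 0 closes; this file discharges none of them.
-/

-- Mathlib idiom (as in ★ `GKModules` and every `(𝔤, K)` file of the tree): commutator bracket on `Module.End` / matrices
attribute [local instance 100] LieRing.ofAssociativeRing

set_option autoImplicit false
set_option linter.dupNamespace false

noncomputable section

open scoped Matrix MatrixGroups ComplexConjugate

namespace Summit.HodgeConjecture.HodgeConjecture.Cruxes.H413.F0P3ValueMapOfFrameVectors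

open Literature.NumberTheory.Automorphic
open Literature.RepresentationTheory.KonnoKonno2007 Literature.RepresentationTheory.KonnoKonno2007.RealDualPair
open Literature.RepresentationTheory.BorelWallach2000
open Summit.HodgeConjecture.HodgeConjecture.Cruxes.H413.F0P3OrbitSmoothVectors
open Summit.HodgeConjecture.HodgeConjecture.Cruxes.H413.F0P3CMFrameOrbit

variable {V : Type*} [AddCommGroup V] [Module ℂ V]
  (ρK : Representation ℂ (uFormGroup (Fin 2) (Fin 1)).maximalCompact V)
  (ρ𝔤 : (uFormGroup (Fin 2) (Fin 1)).lie →ₗ⁅ℝ⁆ Module.End ℂ V)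

/-! ## §1 The value map of a pair of vectors: existence, values on the frame, vanishing -/

/-- **Existence of the value map** with prescribed `𝔭`-entry formula `φ(Y) = ∑ⱼ χ(Y_{(inl j)(inr 0)}) • vⱼ` for a real-linear
`χ : ℂ → ℂ` (`χ = id`: holomorphic; `χ = conj`: antiholomorphic). [cite: BorelWallach2000, II §4.2] -/
theorem exists_valueMap (χ : ℂ →ₗ[ℝ] ℂ) (v : Fin 2 → V) :
    ∃ φ : (uFormGroup (Fin 2) (Fin 1)).lie →ₗ[ℝ] V, ∀ Y : (uFormGroup (Fin 2) (Fin 1)).lie,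
      φ Y = ∑ j : Fin 2, χ ((Y : Matrix (Fin 2 ⊕ Fin 1) (Fin 2 ⊕ Fin 1) ℂ) (Sum.inl j) (Sum.inr 0)) • v j :=
  ⟨∑ j : Fin 2, (χ ∘ₗ upqEntry (j, (0 : Fin 1))).smulRight (v j), fun Y => by
    simp only [LinearMap.coe_sum, Finset.sum_apply, LinearMap.smulRight_apply, LinearMap.coe_comp,
      Function.comp_apply, upqEntry_apply]⟩

/-- **Values on the frame**: `φ (X_{cE_p}) = χ(c) • v_{p.1}`. [cite: BorelWallach2000, VI 4.8 (3)] -/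
theorem valueMap_apply_upqUnit (χ : ℂ →ₗ[ℝ] ℂ) (v : Fin 2 → V) (φ : (uFormGroup (Fin 2) (Fin 1)).lie →ₗ[ℝ] V)
    (hφ : ∀ Y : (uFormGroup (Fin 2) (Fin 1)).lie,
      φ Y = ∑ j : Fin 2, χ ((Y : Matrix (Fin 2 ⊕ Fin 1) (Fin 2 ⊕ Fin 1) ℂ) (Sum.inl j) (Sum.inr 0)) • v j)
    (p : Fin 2 × Fin 1) (c : ℂ) :
    φ (upqUnit p c) = χ c • v p.1 := by
  rw [hφ, Finset.sum_eq_single p.1]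
  · rw [upqUnit_apply_inl_inr, if_pos rfl]
  · intro j _ hj
    rw [upqUnit_apply_inl_inr, if_neg hj, map_zero, zero_smul]
  · exact fun h => absurd (Finset.mem_univ _) h

/-- **The value map vanishes iff the vectors vanish** (for `χ` injective, e.g. `id` or `conj`): `φ = 0 ↔ ∀ j, vⱼ = 0`.
[cite: BorelWallach2000, II §4.2] -/
theorem valueMap_eq_zero_iff (χ : ℂ →ₗ[ℝ] ℂ) (hχ : χ 1 ≠ 0) (v : Fin 2 → V) (φ : (uFormGroup (Fin 2) (Fin 1)).lie →ₗ[ℝ] V)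
    (hφ : ∀ Y : (uFormGroup (Fin 2) (Fin 1)).lie,
      φ Y = ∑ j : Fin 2, χ ((Y : Matrix (Fin 2 ⊕ Fin 1) (Fin 2 ⊕ Fin 1) ℂ) (Sum.inl j) (Sum.inr 0)) • v j) :
    φ = 0 ↔ ∀ j, v j = 0 := by
  constructor
  · intro h j
    have e := valueMap_apply_upqUnit χ v φ hφ (j, 0) 1
    rw [h, LinearMap.zero_apply] at e
    exact (smul_eq_zero.1 e.symm).resolve_left hχ
  · intro h
    ext Y
    rw [hφ, LinearMap.zero_apply]
    exact Finset.sum_eq_zero fun j _ => by rw [h j, smul_zero]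

/-- (h0) **The value map kills `𝔨`** (the `𝔭`-entries of `W ∈ 𝔨` vanish). [cite: BorelWallach2000, II §4.1] -/
theorem valueMap_apply_of_mem_kInLie (χ : ℂ →ₗ[ℝ] ℂ) (v : Fin 2 → V) (φ : (uFormGroup (Fin 2) (Fin 1)).lie →ₗ[ℝ] V)
    (hφ : ∀ Y : (uFormGroup (Fin 2) (Fin 1)).lie,
      φ Y = ∑ j : Fin 2, χ ((Y : Matrix (Fin 2 ⊕ Fin 1) (Fin 2 ⊕ Fin 1) ℂ) (Sum.inl j) (Sum.inr 0)) • v j) :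
    ∀ W ∈ (uFormGroup (Fin 2) (Fin 1)).kInLie, φ W = 0 := by
  intro W hW
  rw [hφ]
  exact Finset.sum_eq_zero fun j _ => by rw [apply_inl_inr_of_mem_kInLie hW, map_zero, zero_smul]

/-! ## §2 The holomorphic value map: the five conditions with type `+i` -/

section Hol

/-- **B1′ (algebraic half), HOLOMORPHIC TYPE.**  Let `(ρK, ρ𝔤)` be a `(𝔤, K)`-module of `U(2,1)_{Fin 2 ⊕ Fin 1}` and
`v₀, v₁ ∈ V` of COTANGENT `K`-type (`ρK(k) vⱼ = ∑ᵢ conj(k₂₂) kᵢⱼ • vᵢ`) satisfying the Cauchy–Riemann relations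
`ρ𝔤(X_{ic}) vⱼ = i • ρ𝔤(X_c) vⱼ` on the frame of `𝔭`.  Then the value map `φ(Y) = ∑ⱼ Y_{(inl j)(inr 0)} • vⱼ` satisfies the five
conditions (h0) ∕ (hK) ∕ (h𝔨) ∕ (hwt) ∕ (hN) of a TYPED NULL VALUE MAP OF TYPE `+1` — the binders `hp0 … hpN` of ★
`F0P3ValueMapTransport.not_both_types_of_detected`, token for token. [cite: BorelWallach2000, II §4.1–4.2 and VI 4.8]
[cite: Rogawski1990, Prop. 15.2.1 (b)] -/
theorem valueMap_hol (hGK : IsGKModule (uFormGroup (Fin 2) (Fin 1)) ρK ρ𝔤) (v : Fin 2 → V)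
    (hKv : ∀ (k : (uFormGroup (Fin 2) (Fin 1)).maximalCompact) (j : Fin 2),
      ρK k (v j) = ∑ i : Fin 2, ((starRingEnd ℂ) (((k : GL (Fin 2 ⊕ Fin 1) ℂ) : Matrix (Fin 2 ⊕ Fin 1) (Fin 2 ⊕ Fin 1) ℂ)
        (Sum.inr 0) (Sum.inr 0)) * ((k : GL (Fin 2 ⊕ Fin 1) ℂ) : Matrix (Fin 2 ⊕ Fin 1) (Fin 2 ⊕ Fin 1) ℂ)
        (Sum.inl i) (Sum.inl j)) • v i)
    (hCR : ∀ (p : Fin 2 × Fin 1) (c : ℂ) (j : Fin 2),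
      ρ𝔤 (upqUnit p (Complex.I * c)) (v j) = Complex.I • ρ𝔤 (upqUnit p c) (v j))
    (φ : (uFormGroup (Fin 2) (Fin 1)).lie →ₗ[ℝ] V)
    (hφ : ∀ Y : (uFormGroup (Fin 2) (Fin 1)).lie,
      φ Y = ∑ j : Fin 2, ((Y : Matrix (Fin 2 ⊕ Fin 1) (Fin 2 ⊕ Fin 1) ℂ) (Sum.inl j) (Sum.inr 0)) • v j) :
    (∀ W ∈ (uFormGroup (Fin 2) (Fin 1)).kInLie, φ W = 0) ∧
    (∀ (k : (uFormGroup (Fin 2) (Fin 1)).maximalCompact) (X : (uFormGroup (Fin 2) (Fin 1)).lie),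
      ρK k (φ X) = φ ((uFormGroup (Fin 2) (Fin 1)).Ad
        (Subgroup.inclusion (uFormGroup (Fin 2) (Fin 1)).maximalCompact_le_carrier k) X)) ∧
    (∀ W ∈ (uFormGroup (Fin 2) (Fin 1)).kInLie, ∀ X : (uFormGroup (Fin 2) (Fin 1)).lie, φ ⁅W, X⁆ = ρ𝔤 W (φ X)) ∧
    (∀ X : (uFormGroup (Fin 2) (Fin 1)).lie, ρ𝔤 (upqZ0 (Fin 2) (Fin 1)) (φ X) = Complex.I • φ X) ∧
    (∀ (X : (uFormGroup (Fin 2) (Fin 1)).lie) (s : (Fin 2 × Fin 1) × Fin 2),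
      ρ𝔤 (upqPBasis s) (φ X) + Complex.I • ρ𝔤 ⁅upqZ0 (Fin 2) (Fin 1), upqPBasis s⁆ (φ X) = 0) := by
  have hφ' : ∀ Y : (uFormGroup (Fin 2) (Fin 1)).lie, φ Y = ∑ j : Fin 2,
      LinearMap.id (R := ℝ) ((Y : Matrix (Fin 2 ⊕ Fin 1) (Fin 2 ⊕ Fin 1) ℂ) (Sum.inl j) (Sum.inr 0)) • v j := hφ
  -- (h0)
  have h0 : ∀ W ∈ (uFormGroup (Fin 2) (Fin 1)).kInLie, φ W = 0 := valueMap_apply_of_mem_kInLie LinearMap.id v φ hφ'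
  -- (hK): both sides are `∑ⱼ ∑ᵢ Yⱼ conj(k₂₂) kᵢⱼ • vᵢ`
  have hK : ∀ (k : (uFormGroup (Fin 2) (Fin 1)).maximalCompact) (X : (uFormGroup (Fin 2) (Fin 1)).lie),
      ρK k (φ X) = φ ((uFormGroup (Fin 2) (Fin 1)).Ad
        (Subgroup.inclusion (uFormGroup (Fin 2) (Fin 1)).maximalCompact_le_carrier k) X) := by
    intro k X
    rw [hφ, hφ, map_sum]
    simp_rw [map_smul, hKv, Ad_K_apply_inl_inr, Finset.smul_sum, Finset.sum_smul, smul_smul]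
    rw [Finset.sum_comm]
    refine Finset.sum_congr rfl fun i _ => Finset.sum_congr rfl fun j _ => ?_
    ring_nf
  -- (h𝔨): differentiate (hK) weakly (★ `lie_apply_eq_of_K_equivariant`)
  have h𝔨 : ∀ W ∈ (uFormGroup (Fin 2) (Fin 1)).kInLie, ∀ X : (uFormGroup (Fin 2) (Fin 1)).lie,
      φ ⁅W, X⁆ = ρ𝔤 W (φ X) :=
    lie_apply_eq_of_K_equivariant (uFormGroup (Fin 2) (Fin 1)) hGK φ hK
  -- (hwt): `ρ(z₀) φ(X) = φ(⁅z₀, X⁆)` and the `𝔭`-entries of `⁅z₀, X⁆` are `i` times those of `X`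
  have hwt : ∀ X : (uFormGroup (Fin 2) (Fin 1)).lie, ρ𝔤 (upqZ0 (Fin 2) (Fin 1)) (φ X) = Complex.I • φ X := by
    intro X
    rw [← h𝔨 _ upqZ0_mem_kInLie X, hφ, hφ, Finset.smul_sum]
    refine Finset.sum_congr rfl fun j _ => ?_
    rw [lie_upqZ0_apply_inl_inr, mul_smul]
  -- (hN): Cauchy–Riemann on the frame, `1 + i² = 0`
  have hN : ∀ (X : (uFormGroup (Fin 2) (Fin 1)).lie) (s : (Fin 2 × Fin 1) × Fin 2),
      ρ𝔤 (upqPBasis s) (φ X) + Complex.I • ρ𝔤 ⁅upqZ0 (Fin 2) (Fin 1), upqPBasis s⁆ (φ X) = 0 := by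
    intro X s
    rw [upqPBasis, lie_upqZ0_upqUnit, hφ, map_sum, map_sum, Finset.smul_sum, ← Finset.sum_add_distrib]
    refine Finset.sum_eq_zero fun j _ => ?_
    rw [map_smul, map_smul, hCR, smul_comm Complex.I, ← smul_assoc Complex.I Complex.I, smul_eq_mul, Complex.I_mul_I,
      ← smul_add, neg_one_smul, add_neg_cancel, smul_zero]
  exact ⟨h0, hK, h𝔨, hwt, hN⟩

end Hol

/-! ## §3 The antiholomorphic value map: the five conditions with type `−i` -/

section Antihol

/-- **B1′ (algebraic half), ANTIHOLOMORPHIC TYPE.**  Let `w₀, w₁ ∈ V` have the CONJUGATE cotangent `K`-type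
`ρK(k) wⱼ = ∑ᵢ conj(conj(k₂₂) kᵢⱼ) • wᵢ` (the classes of the coordinates of the componentwise conjugate of a holomorphic cotangent
form) and satisfy the anti-Cauchy–Riemann relations `ρ𝔤(X_{ic}) wⱼ = −i • ρ𝔤(X_c) wⱼ`.  Then the CONJUGATE-LINEAR value map
`φ(Y) = ∑ⱼ conj(Y_{(inl j)(inr 0)}) • wⱼ` satisfies (h0) ∕ (hK) ∕ (h𝔨) ∕ (hwt) ∕ (hN) of a typed null value map of TYPE `−1` —
the binders `hm0 … hmN` of ★ `F0P3ValueMapTransport.not_both_types_of_detected`, token for token.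
[cite: BorelWallach2000, II §4.1–4.2 and VI 4.8] [cite: Rogawski1990, Prop. 15.2.1 (b)] -/
theorem valueMap_antihol (hGK : IsGKModule (uFormGroup (Fin 2) (Fin 1)) ρK ρ𝔤) (w : Fin 2 → V)
    (hKw : ∀ (k : (uFormGroup (Fin 2) (Fin 1)).maximalCompact) (j : Fin 2),
      ρK k (w j) = ∑ i : Fin 2, (starRingEnd ℂ) ((starRingEnd ℂ) (((k : GL (Fin 2 ⊕ Fin 1) ℂ) :
        Matrix (Fin 2 ⊕ Fin 1) (Fin 2 ⊕ Fin 1) ℂ) (Sum.inr 0) (Sum.inr 0)) *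
        ((k : GL (Fin 2 ⊕ Fin 1) ℂ) : Matrix (Fin 2 ⊕ Fin 1) (Fin 2 ⊕ Fin 1) ℂ) (Sum.inl i) (Sum.inl j)) • w i)
    (hCR : ∀ (p : Fin 2 × Fin 1) (c : ℂ) (j : Fin 2),
      ρ𝔤 (upqUnit p (Complex.I * c)) (w j) = (-Complex.I) • ρ𝔤 (upqUnit p c) (w j))
    (φ : (uFormGroup (Fin 2) (Fin 1)).lie →ₗ[ℝ] V)
    (hφ : ∀ Y : (uFormGroup (Fin 2) (Fin 1)).lie,
      φ Y = ∑ j : Fin 2, (starRingEnd ℂ) ((Y : Matrix (Fin 2 ⊕ Fin 1) (Fin 2 ⊕ Fin 1) ℂ) (Sum.inl j) (Sum.inr 0)) • w j) :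
    (∀ W ∈ (uFormGroup (Fin 2) (Fin 1)).kInLie, φ W = 0) ∧
    (∀ (k : (uFormGroup (Fin 2) (Fin 1)).maximalCompact) (X : (uFormGroup (Fin 2) (Fin 1)).lie),
      ρK k (φ X) = φ ((uFormGroup (Fin 2) (Fin 1)).Ad
        (Subgroup.inclusion (uFormGroup (Fin 2) (Fin 1)).maximalCompact_le_carrier k) X)) ∧
    (∀ W ∈ (uFormGroup (Fin 2) (Fin 1)).kInLie, ∀ X : (uFormGroup (Fin 2) (Fin 1)).lie, φ ⁅W, X⁆ = ρ𝔤 W (φ X)) ∧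
    (∀ X : (uFormGroup (Fin 2) (Fin 1)).lie, ρ𝔤 (upqZ0 (Fin 2) (Fin 1)) (φ X) = (-Complex.I) • φ X) ∧
    (∀ (X : (uFormGroup (Fin 2) (Fin 1)).lie) (s : (Fin 2 × Fin 1) × Fin 2),
      ρ𝔤 (upqPBasis s) (φ X) + (-Complex.I) • ρ𝔤 ⁅upqZ0 (Fin 2) (Fin 1), upqPBasis s⁆ (φ X) = 0) := by
  have hφ' : ∀ Y : (uFormGroup (Fin 2) (Fin 1)).lie, φ Y = ∑ j : Fin 2,
      Complex.conjLIE.toLinearEquiv.toLinearMap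
        ((Y : Matrix (Fin 2 ⊕ Fin 1) (Fin 2 ⊕ Fin 1) ℂ) (Sum.inl j) (Sum.inr 0)) • w j := hφ
  -- (h0)
  have h0 : ∀ W ∈ (uFormGroup (Fin 2) (Fin 1)).kInLie, φ W = 0 := valueMap_apply_of_mem_kInLie _ w φ hφ'
  -- (hK)
  have hK : ∀ (k : (uFormGroup (Fin 2) (Fin 1)).maximalCompact) (X : (uFormGroup (Fin 2) (Fin 1)).lie),
      ρK k (φ X) = φ ((uFormGroup (Fin 2) (Fin 1)).Ad
        (Subgroup.inclusion (uFormGroup (Fin 2) (Fin 1)).maximalCompact_le_carrier k) X) := by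
    intro k X
    rw [hφ, hφ, map_sum]
    simp_rw [map_smul, hKw, Ad_K_apply_inl_inr, map_sum, map_mul, Finset.smul_sum, Finset.sum_smul, smul_smul]
    rw [Finset.sum_comm]
    refine Finset.sum_congr rfl fun i _ => Finset.sum_congr rfl fun j _ => ?_
    ring_nf
  -- (h𝔨)
  have h𝔨 : ∀ W ∈ (uFormGroup (Fin 2) (Fin 1)).kInLie, ∀ X : (uFormGroup (Fin 2) (Fin 1)).lie,
      φ ⁅W, X⁆ = ρ𝔤 W (φ X) :=
    lie_apply_eq_of_K_equivariant (uFormGroup (Fin 2) (Fin 1)) hGK φ hK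
  -- (hwt)
  have hwt : ∀ X : (uFormGroup (Fin 2) (Fin 1)).lie, ρ𝔤 (upqZ0 (Fin 2) (Fin 1)) (φ X) = (-Complex.I) • φ X := by
    intro X
    rw [← h𝔨 _ upqZ0_mem_kInLie X, hφ, hφ, Finset.smul_sum]
    refine Finset.sum_congr rfl fun j _ => ?_
    rw [lie_upqZ0_apply_inl_inr, map_mul, Complex.conj_I, mul_smul]
  -- (hN)
  have hN : ∀ (X : (uFormGroup (Fin 2) (Fin 1)).lie) (s : (Fin 2 × Fin 1) × Fin 2),
      ρ𝔤 (upqPBasis s) (φ X) + (-Complex.I) • ρ𝔤 ⁅upqZ0 (Fin 2) (Fin 1), upqPBasis s⁆ (φ X) = 0 := by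
    intro X s
    rw [upqPBasis, lie_upqZ0_upqUnit, hφ, map_sum, map_sum, Finset.smul_sum, ← Finset.sum_add_distrib]
    refine Finset.sum_eq_zero fun j _ => ?_
    rw [map_smul, map_smul, hCR, smul_comm (-Complex.I), ← smul_assoc (-Complex.I) (-Complex.I), smul_eq_mul,
      neg_mul_neg, Complex.I_mul_I, ← smul_add, neg_one_smul, add_neg_cancel, smul_zero]
  exact ⟨h0, hK, h𝔨, hwt, hN⟩

end Antihol

end Summit.HodgeConjecture.HodgeConjecture.Cruxes.H413.F0P3ValueMapOfFrameVectors

end
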